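import Literature.Topology.FourManifolds.HalfDiscFromCollar
import Literature.Topology.FourManifolds.CollarTheoremGeneral
import HarnessLib

/-!
# Half-discs with prescribed flat face: discharge of `exists_halfDisc_face_eq`

Topic `Literature/Topology/FourManifolds` (fact seat
`provefact-Literature.Topology.FourManifolds.exists_halfDisc_face_eq`).  Everything here is proved.

* `Literature.Topology.FourManifolds.exists_halfDisc_face_eq_holds` — **discharge of the named fact
  `Literature.Topology.FourManifolds.exists_halfDisc_face_eq`** of `CorkDecompositionSplitting.lean` (leaf (R0') under
  Matveyev's cork decomposition): for a smooth manifold with boundary `A` of dimension `n + 2`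
  (Hausdorff, second countable; compact or not), a boundary datum `b` and a disc
  `f : ℝⁿ⁺¹ ↪ ∂A` (smooth embedding with open range) there is a half-disc `k : ℝⁿ⁺²₊ ↪ A` (smooth
  embedding of the closed half space with open range) with flat face `k (0, x') = b.incl (f x')`.
  Proof as printed in the docstring of the fact (Hirsch, *Differential Topology* (1976), Ch. 4 §6,
  Thm. 6.1: collars): `k (x₀, x') = c (f x', σ x₀)` for a collar `c` of `∂A`
  (`Literature.Topology.FourManifolds.exists_halfDisc_face_eq_of_nonempty_collar`, `HalfDiscFromCollar.lean`), the collar being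
  provided for *every* such `A` by the general collar theorem
  `Literature.Topology.FourManifolds.BoundaryData.nonempty_collar_holds` (`CollarTheoremGeneral.lean`).

## References

* M. W. Hirsch, *Differential Topology*, GTM 33 (1976), Ch. 4 §6, Thm. 6.1 (collaring theorem),
  Ch. 6 §2, Thm. 2.1 (its proof by differential equations). [Hirsch1976]
* R. Matveyev, *A decomposition of smooth simply-connected h-cobordant 4-manifolds*,
  J. Differential Geom. 44 (1996), 571–582, proof of part 2 of the Theorem (fig. 2).
-/

noncomputable section

namespace Literature.Topology.FourManifolds

universe u

/-- **Half-discs with prescribed flat face exist** — discharge of the named fact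
`Literature.Topology.FourManifolds.exists_halfDisc_face_eq`: every disc `f : ℝⁿ⁺¹ ↪ ∂A` of the boundary of a smooth
`(n+2)`-manifold with boundary `A` (Hausdorff, second countable) is the flat face of a half-disc
`k : ℝⁿ⁺²₊ ↪ A`, `k (0, x') = b.incl (f x')`.  By `k (x₀, x') = c (f x', σ x₀)` for a collar `c`
of `∂A` (`HalfDiscFromCollar.lean`) and the collaring theorem
`Literature.Topology.FourManifolds.BoundaryData.nonempty_collar_holds`. [cite: Hirsch1976, Ch. 4 §6 Thm. 6.1 (collaring theorem, p. 113)] -/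
theorem exists_halfDisc_face_eq_holds : exists_halfDisc_face_eq.{u} :=
  exists_halfDisc_face_eq_of_nonempty_collar BoundaryData.nonempty_collar_holds

end Literature.Topology.FourManifolds
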